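import Summits.QuantumFields.BalabanUV.Beta.GAN24.DerivativeRateTransferJensenMassFree

/-!
# `BalabanUV.Beta.GAN24.DerivativeRateTransferJensenMassFreeEnd` — binder row G-an2-4 ∕ (CONV-C), route R6 «VALUES, NOT DERIVATIVES», PART 53:
# THE MASS-FREE COVARIANT JENSEN INEQUALITY, II — THE POLAR END WITH `δ = 0`: the coarse mass is FINE ENERGY at first order in the holonomy letter
# `κ²`, so `⟨Qu, H_cQu⟩ ≤ (1 + ε)·⟨u, H_f u⟩` for the polar pair with NO additive Gram term (unit b2b-balaban-gan24-p3, gen 43; v1; mechanism «the coarse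
# mass is loop energy» = gan24-idea-1 g56's LENS ITEM 13 ∕ L-idea1-g56-1 — credited, typed here through the block means rather than a lattice loop)

NOT IN PRINT; OUR PROOF (for the ROUTE; [folklore] finite-dimensional linear algebra over `ℝ` — PARTs 21 ∕ 22 ∕ 47 ∕ 52 BY NAME).  HONEST FRAMING (cell
contract, verbatim): «discharging `BetaPertH` makes Bałaban's UV stability UNCONDITIONAL — a real constructive-QFT result; it is NOT the continuum limit
and NOT the Clay problem.»  HONEST DEPENDENCY (verbatim): «continuum YM on T⁴ ⇐ BetaPertH ∧ nine spine estimates (0/9 proved); BetaPertH ⇐ (D1) ∧ (D4) ∧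
CAP+tail; G-an2-4 gates asym, D1 and NE2/3/4.»

WHY THIS FILE.  PART 52 proved (§1) the polar mass lemma `(4 − κ²)|S c|² ≤ κ²Σ_x q_x|V_xc − a|²` for any centre `a` and (§2) PART 47's END with a
per-bond mass datum `|S_{e′}·R′(Qu)(y′)|² ≤ Ψ(e′)`, `w_cΣ_{e′}Ψ(e′) ≤ Z`.  THIS FILE supplies the datum for the POLAR pair and closes the END.  (§3)
`massDatum_polar_le`: one coarse bond `e′ = (y → y′)`, centre `a := (Qu)(y)`; since `R′ᵀR′ = 1`, `V_x·R′(Qu)(y′) = W(y,x)T_xW(y′,σx)ᵀ(Qu)(y′)`, and this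
vector minus `(Qu)(y)` TELESCOPES through the field values, `W_xT_x(W′_xᵀ(Qu)(y′) − u(σx)) + W_x(T_xu(σx) − u(x)) + (W_xu(x) − (Qu)(y))` — a Poincaré
fluctuation at `y′` (reindexed by `σ`), a transported CHAIN of `ℓ` fine differences (PART 21), a Poincaré fluctuation at `y` — whence
  `|S_{e′}·R′(Qu)(y′)|² ≤ 3κ²∕(4 − κ²)·[Σ_x q(y′,x)|W(y′,x)u(x) − (Qu)(y′)|² + ℓ·Σ_x q(y,x)Σ_{i<ℓ}|D_{γ(e′,x,i)}u|² + Σ_x q(y,x)|W(y,x)u(x) − (Qu)(y)|²]`: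
THE COARSE MASS IS FINE ENERGY.  (§4) `sum_coarseDiff_sq_le_polar` ∕ `covJensen_polar_massFree`: PART 47's letters with `Σ_x q(y,x) = 1`, `R′` orthogonal,
the POLAR letter «`Σ_x q(src′e′,x)·N(e′,x)` symmetric» (PART 51 `wsum_defect_symm_of_polar`), the Poincaré budget at BOTH ends of a coarse bond (`ϖ` at
targets, `ϖ′` at sources) and `κ² < 4` ⟹ for all `t, r > 0`
  `⟨Qu, H_cQu⟩ ≤ (1 + t + (1+t⁻¹)(1+r)ϖκ² + (1+t⁻¹)(1+r⁻¹)·3κ²(1 + ϖ + ϖ′)∕(4 − κ²))·⟨u, H_f u⟩`     — `δ = 0`;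
at `t = κ ≤ 1`, `r = 1`: `ε = (1 + 2(1+κ)(1 + 2ϖ + ϖ′))·κ` (PART 56; PART 51 at the same ε-order carries `δ = (1+κ)κ³∕2·w_c d′`); the Loewner form PART 20 `effForm_step_posSemidef_of_stabGram` consumes has the `δ•G` summand ABSENT
(`posSemidef_covJensen_polar_massFree`), so PART 20 §6's tower product `Π_j(1 + ε_j)` needs only `Σ_j κ_j < ∞` for this convention (pricing: the desk's).

WHAT THIS FILE PROVES (0 sorry, 0 `def`, nothing cited): §3 `dotProduct_self_add_add_le_three`, **`massDatum_polar_le`**; §4 **`sum_coarseDiff_sq_le_polar`**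
(the bound on the weighted coarse bond energy itself — the input of PART 56's convention-transfer END), **`covJensen_polar_massFree`**,
**`posSemidef_covJensen_polar_massFree`** (the first-order form `ε = C·κ` and the transfer to a second coarse connection are PART 56).
WHAT IT DOES NOT DO: the block-lattice instance ∕ the tree discharge of `Φ ∕ ϖ ∕ ϖ′` (next PARTs), the EXISTENCE of the polar factor for `SU(N)`,
(1.27) ∕ (1.28), `κ ≤ C·p̂`, anything of Bałaban's (`G_k`, `H_k`, `C^{(k)}`), (CONS), exact (STAB).  SUPPLIER work on route R6 (rank 2, REDUCTION, no
seat); NEVER «G-an2-4 closed»; NOT (CONV-C), NOT D1, NOT `BetaPertH`, NOT continuum, NOT Clay.  Records: `HOME/b2b-balaban-gan24-p3/WOODBURY-FIBRE.md` v14.3. -/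

noncomputable section

open Matrix Finset

namespace Summit.QuantumFields.BalabanUV.Beta.GAN24.DerivativeRateTransferJensenMassFreeEnd

open Summit.QuantumFields.BalabanUV.Beta.GAN24.DerivativeRateTransferLoewnerKKT (mulVec_dotProduct_eq)
open Summit.QuantumFields.BalabanUV.Beta.GAN24.DerivativeRateTransferJensenChain
open Summit.QuantumFields.BalabanUV.Beta.GAN24.DerivativeRateTransferJensen
open Summit.QuantumFields.BalabanUV.Beta.GAN24.DerivativeRateTransferJensenMeanZero
open Summit.QuantumFields.BalabanUV.Beta.GAN24.DerivativeRateTransferJensenMassFree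

/-! ## §3 The polar mass datum: the coarse mass is fine energy -/

section PolarDatum

variable {o μ ν β β' : Type*} [Fintype o] [DecidableEq o] [Fintype μ] [Fintype ν] [Fintype β] [DecidableEq β] [Fintype β']
variable {q : μ → ν → ℝ} {W : μ → ν → Matrix o o ℝ} {Q : Matrix (μ × o) (ν × o) ℝ}
variable {src tgt : β → ν} {R : β → Matrix o o ℝ} {src' tgt' : β' → μ} {R' : β' → Matrix o o ℝ}
variable {σ : β' → ν ≃ ν} {ℓ : ℕ} {xs : β' → ν → ℕ → ν} {γ : β' → ν → ℕ → β} {T : β' → ν → ℕ → Matrix o o ℝ}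
variable {N : β' → ν → Matrix o o ℝ} {Φ : (ν × o → ℝ) → μ → ℝ} {κ : ℝ}

omit [DecidableEq o] [Fintype μ] [Fintype ν] [Fintype β] [DecidableEq β] [Fintype β'] in
/-- `|a + b + c|² ≤ 3(|a|² + |b|² + |c|²)` (PART 47's three-term Peter–Paul at `t = 2`, `r = 1`). [folklore] -/
theorem dotProduct_self_add_add_le_three (a b c : o → ℝ) :
    (a + b + c) ⬝ᵥ (a + b + c) ≤ 3 * ((a ⬝ᵥ a) + (b ⬝ᵥ b) + (c ⬝ᵥ c)) := by
  have h := dotProduct_self_add_add_le a b c (t := 2) (r := 1) two_pos one_pos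
  have e : (1 + 2) * (a ⬝ᵥ a) + (1 + (2 : ℝ)⁻¹) * ((1 + 1) * (b ⬝ᵥ b) + (1 + (1 : ℝ)⁻¹) * (c ⬝ᵥ c)) =
      3 * ((a ⬝ᵥ a) + (b ⬝ᵥ b) + (c ⬝ᵥ c)) := by ring
  rw [e] at h
  exact h

omit [Fintype μ] [Fintype β] [DecidableEq β] [Fintype β'] in
/-- **`massDatum_polar_le` — THE COARSE MASS IS FINE ENERGY** [our proof].  One coarse bond `e′ = (y → y′)` of PART 47's setting with `Σ_x q(y,x) = 1`,
`R′_{e′}` orthogonal, the POLAR letter «`S_{e′} = Σ_x q(y,x)·N(e′,x)` symmetric» and `κ² < 4`: with `b̄ = (Qu)(y′)`,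
`|S_{e′}·R′b̄|² ≤ 3κ²∕(4 − κ²)·[Σ_x q(y′,x)|W(y′,x)u(x) − b̄|² + ℓ·Σ_x q(y,x)Σ_{i<ℓ}|D_{γ(e′,x,i)}u|² + Σ_x q(y,x)|W(y,x)u(x) − (Qu)(y)|²]`
(the polar mass lemma with centre `(Qu)(y)`; each `V_xR′b̄ − (Qu)(y)` telescopes through `u(σx)` and `u(x)` into a Poincaré fluctuation at `y′`, a
transported chain of fine differences and a Poincaré fluctuation at `y`). -/
theorem massDatum_polar_le
    (hq : ∀ y x, 0 ≤ q y x) (hq1 : ∀ y, ∑ x, q y x = 1) (hW : ∀ y x, (W y x)ᵀ * W y x = 1) (hR : ∀ e, (R e)ᵀ * R e = 1)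
    (hR' : ∀ e', (R' e')ᵀ * R' e' = 1)
    (hσq : ∀ e' x, q (tgt' e') (σ e' x) = q (src' e') x)
    (hx0 : ∀ e' x, xs e' x 0 = x) (hxℓ : ∀ e' x, xs e' x ℓ = σ e' x)
    (hsrc : ∀ e' x i, i < ℓ → src (γ e' x i) = xs e' x i) (htgt : ∀ e' x i, i < ℓ → tgt (γ e' x i) = xs e' x (i + 1))
    (hT0 : ∀ e' x, T e' x 0 = 1) (hT : ∀ e' x i, i < ℓ → T e' x (i + 1) = T e' x i * R (γ e' x i))
    (hNdef : ∀ e' x, N e' x = 1 - W (src' e') x * T e' x ℓ * (W (tgt' e') (σ e' x))ᵀ * (R' e')ᵀ)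
    (hN : ∀ e' x (w : o → ℝ), (N e' x *ᵥ w) ⬝ᵥ (N e' x *ᵥ w) ≤ κ ^ 2 * (w ⬝ᵥ w))
    (hsym : ∀ e', (∑ x, q (src' e') x • N e' x)ᵀ = ∑ x, q (src' e') x • N e' x) (hκ : κ ^ 2 < 4)
    (u : ν × o → ℝ) (e' : β') :
    ((∑ x, q (src' e') x • N e' x) *ᵥ (R' e' *ᵥ fun a => (Q *ᵥ u) (tgt' e', a))) ⬝ᵥ
        ((∑ x, q (src' e') x • N e' x) *ᵥ (R' e' *ᵥ fun a => (Q *ᵥ u) (tgt' e', a))) ≤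
      3 * κ ^ 2 / (4 - κ ^ 2) *
        (∑ x, q (tgt' e') x * (((W (tgt' e') x *ᵥ fun b => u (x, b)) - fun a => (Q *ᵥ u) (tgt' e', a)) ⬝ᵥ
            ((W (tgt' e') x *ᵥ fun b => u (x, b)) - fun a => (Q *ᵥ u) (tgt' e', a))) +
          ℓ * ∑ x, q (src' e') x * ∑ i ∈ range ℓ,
            ((R (γ e' x i) *ᵥ fun b => u (tgt (γ e' x i), b)) - fun b => u (src (γ e' x i), b)) ⬝ᵥ
              ((R (γ e' x i) *ᵥ fun b => u (tgt (γ e' x i), b)) - fun b => u (src (γ e' x i), b)) +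
          ∑ x, q (src' e') x * (((W (src' e') x *ᵥ fun b => u (x, b)) - fun a => (Q *ᵥ u) (src' e', a)) ⬝ᵥ
            ((W (src' e') x *ᵥ fun b => u (x, b)) - fun a => (Q *ᵥ u) (src' e', a)))) := by
  -- abbreviations
  set y := src' e' with hy
  set y' := tgt' e' with hy'
  set bbar : o → ℝ := fun a => (Q *ᵥ u) (y', a) with hbbar
  set abar : o → ℝ := fun a => (Q *ᵥ u) (y, a) with habar
  set V : ν → Matrix o o ℝ := fun x => W y x * T e' x ℓ * (W y' (σ e' x))ᵀ * (R' e')ᵀ with hVdef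
  have hTl : ∀ x, (T e' x ℓ)ᵀ * T e' x ℓ = 1 := fun x =>
    orthogonal_partialTransport (R := fun i => R (γ e' x i)) (fun i _ => hR _) (hT0 e' x) (fun i hi => hT e' x i hi) ℓ le_rfl
  have hVo : ∀ x, (V x)ᵀ * V x = 1 := fun x =>
    orthogonal_mul (orthogonal_mul (orthogonal_mul (hW _ _) (hTl x)) (transpose_orthogonal (hW _ _))) (transpose_orthogonal (hR' e'))
  have hNV : ∀ x, N e' x = 1 - V x := fun x => by rw [hNdef e' x]
  -- Step A: the polar mass lemma with centre `(Qu)(y)`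
  have hsymV : (∑ x, q y x • (1 - V x))ᵀ = ∑ x, q y x • (1 - V x) := by
    have hs := hsym e'; simp_rw [hNV] at hs; exact hs
  have hκV : ∀ x ∈ (Finset.univ : Finset ν), ∀ w : o → ℝ, (((1 - V x) *ᵥ w) ⬝ᵥ ((1 - V x) *ᵥ w)) ≤ κ ^ 2 * (w ⬝ᵥ w) :=
    fun x _ w => by rw [← hNV x]; exact hN e' x w
  have hA := meanDefect_sq_le_wmoment Finset.univ (fun x _ => hq y x) (hq1 y) (fun x _ => hVo x) hκV hsymV (R' e' *ᵥ bbar) abar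
  simp_rw [← hNV] at hA
  -- Step B: `V_x R′b̄ − (Qu)(y)` telescopes through `u(σx)`, `u(x)`
  have hB : ∀ x, (V x *ᵥ (R' e' *ᵥ bbar) - abar) ⬝ᵥ (V x *ᵥ (R' e' *ᵥ bbar) - abar) ≤
      3 * ((((W y' (σ e' x) *ᵥ fun b => u (σ e' x, b)) - bbar) ⬝ᵥ ((W y' (σ e' x) *ᵥ fun b => u (σ e' x, b)) - bbar)) +
        ((T e' x ℓ *ᵥ (fun b => u (σ e' x, b)) - fun b => u (x, b)) ⬝ᵥ (T e' x ℓ *ᵥ (fun b => u (σ e' x, b)) - fun b => u (x, b))) +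
        (((W y x *ᵥ fun b => u (x, b)) - abar) ⬝ᵥ ((W y x *ᵥ fun b => u (x, b)) - abar))) := by
    intro x
    have hWWt : (W y' (σ e' x))ᵀ * W y' (σ e' x) = 1 := hW _ _
    have e1 : V x *ᵥ (R' e' *ᵥ bbar) = W y x *ᵥ (T e' x ℓ *ᵥ ((W y' (σ e' x))ᵀ *ᵥ bbar)) := by
      simp only [hVdef, mulVec_mulVec]
      congr 1
      calc W y x * T e' x ℓ * (W y' (σ e' x))ᵀ * (R' e')ᵀ * R' e'
          = W y x * (T e' x ℓ * (W y' (σ e' x))ᵀ) * ((R' e')ᵀ * R' e') := by simp only [Matrix.mul_assoc]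
        _ = W y x * (T e' x ℓ * (W y' (σ e' x))ᵀ) := by rw [hR' e', Matrix.mul_one]
    have e2 : V x *ᵥ (R' e' *ᵥ bbar) - abar =
        W y x *ᵥ (T e' x ℓ *ᵥ (((W y' (σ e' x))ᵀ *ᵥ bbar) - fun b => u (σ e' x, b))) +
          W y x *ᵥ (T e' x ℓ *ᵥ (fun b => u (σ e' x, b)) - fun b => u (x, b)) +
          ((W y x *ᵥ fun b => u (x, b)) - abar) := by
      rw [e1, mulVec_sub, mulVec_sub, mulVec_sub]; abel
    rw [e2]
    refine (dotProduct_self_add_add_le_three _ _ _).trans (le_of_eq ?_)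
    congr 2
    · congr 1
      · rw [self_of_orthogonal (hW y x), self_of_orthogonal (hTl x)]
        -- `|W′ᵀb̄ − u(σx)|² = |W′u(σx) − b̄|²`
        have e3 : ((W y' (σ e' x))ᵀ *ᵥ bbar) - (fun b => u (σ e' x, b)) =
            -((W y' (σ e' x))ᵀ *ᵥ ((W y' (σ e' x) *ᵥ fun b => u (σ e' x, b)) - bbar)) := by
          rw [mulVec_sub, mulVec_mulVec, hWWt, one_mulVec]; abel
        rw [e3, neg_dotProduct, dotProduct_neg, neg_neg, self_of_orthogonal (transpose_orthogonal hWWt)]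
      · rw [self_of_orthogonal (hW y x)]
  -- Step C: sum with the weights `q(y,·)`; the chain bound; reindex the `y′`-fluctuation by `σ`
  have hC : ∑ x, q y x * ((V x *ᵥ (R' e' *ᵥ bbar) - abar) ⬝ᵥ (V x *ᵥ (R' e' *ᵥ bbar) - abar)) ≤
      3 * (∑ x, q y' x * (((W y' x *ᵥ fun b => u (x, b)) - bbar) ⬝ᵥ ((W y' x *ᵥ fun b => u (x, b)) - bbar)) +
        ℓ * ∑ x, q y x * ∑ i ∈ range ℓ,
          ((R (γ e' x i) *ᵥ fun b => u (tgt (γ e' x i), b)) - fun b => u (src (γ e' x i), b)) ⬝ᵥ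
            ((R (γ e' x i) *ᵥ fun b => u (tgt (γ e' x i), b)) - fun b => u (src (γ e' x i), b)) +
        ∑ x, q y x * (((W y x *ᵥ fun b => u (x, b)) - abar) ⬝ᵥ ((W y x *ᵥ fun b => u (x, b)) - abar))) := by
    have hfl : ∑ x, q y x * ((((W y' (σ e' x) *ᵥ fun b => u (σ e' x, b)) - bbar) ⬝ᵥ ((W y' (σ e' x) *ᵥ fun b => u (σ e' x, b)) - bbar))) =
        ∑ x, q y' x * (((W y' x *ᵥ fun b => u (x, b)) - bbar) ⬝ᵥ ((W y' x *ᵥ fun b => u (x, b)) - bbar)) := by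
      simp_rw [hy, hy', ← hσq e']
      exact Equiv.sum_comp (σ e') (fun x => q (tgt' e') x *
        (((W (tgt' e') x *ᵥ fun b => u (x, b)) - bbar) ⬝ᵥ ((W (tgt' e') x *ᵥ fun b => u (x, b)) - bbar)))
    have hch : ∀ x, q y x * (((T e' x ℓ *ᵥ (fun b => u (σ e' x, b)) - fun b => u (x, b)) ⬝ᵥ
        (T e' x ℓ *ᵥ (fun b => u (σ e' x, b)) - fun b => u (x, b)))) ≤
        q y x * (ℓ * ∑ i ∈ range ℓ, ((R (γ e' x i) *ᵥ fun b => u (tgt (γ e' x i), b)) - fun b => u (src (γ e' x i), b)) ⬝ᵥ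
          ((R (γ e' x i) *ᵥ fun b => u (tgt (γ e' x i), b)) - fun b => u (src (γ e' x i), b))) := by
      intro x
      refine mul_le_mul_of_nonneg_left ?_ (hq y x)
      have h := dotProduct_self_chain_le (R := fun i => R (γ e' x i)) (T := T e' x) (fun i _ => hR _) (hT0 e' x)
        (fun i hi => hT e' x i hi) (fun i => fun b => u (xs e' x i, b))
      rw [hxℓ, hx0] at h
      refine h.trans (le_of_eq ?_)
      congr 1
      exact Finset.sum_congr rfl fun i hi => by rw [hsrc e' x i (mem_range.mp hi), htgt e' x i (mem_range.mp hi)]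
    calc ∑ x, q y x * ((V x *ᵥ (R' e' *ᵥ bbar) - abar) ⬝ᵥ (V x *ᵥ (R' e' *ᵥ bbar) - abar))
        ≤ ∑ x, q y x * (3 * ((((W y' (σ e' x) *ᵥ fun b => u (σ e' x, b)) - bbar) ⬝ᵥ ((W y' (σ e' x) *ᵥ fun b => u (σ e' x, b)) - bbar)) +
            ((T e' x ℓ *ᵥ (fun b => u (σ e' x, b)) - fun b => u (x, b)) ⬝ᵥ (T e' x ℓ *ᵥ (fun b => u (σ e' x, b)) - fun b => u (x, b))) +
            (((W y x *ᵥ fun b => u (x, b)) - abar) ⬝ᵥ ((W y x *ᵥ fun b => u (x, b)) - abar)))) :=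
          Finset.sum_le_sum fun x _ => mul_le_mul_of_nonneg_left (hB x) (hq y x)
      _ = 3 * (∑ x, q y x * ((((W y' (σ e' x) *ᵥ fun b => u (σ e' x, b)) - bbar) ⬝ᵥ ((W y' (σ e' x) *ᵥ fun b => u (σ e' x, b)) - bbar))) +
            ∑ x, q y x * (((T e' x ℓ *ᵥ (fun b => u (σ e' x, b)) - fun b => u (x, b)) ⬝ᵥ
              (T e' x ℓ *ᵥ (fun b => u (σ e' x, b)) - fun b => u (x, b)))) +
            ∑ x, q y x * (((W y x *ᵥ fun b => u (x, b)) - abar) ⬝ᵥ ((W y x *ᵥ fun b => u (x, b)) - abar))) := by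
          rw [← Finset.sum_add_distrib, ← Finset.sum_add_distrib, Finset.mul_sum]
          exact Finset.sum_congr rfl fun x _ => by ring
      _ ≤ _ := by
          rw [hfl]
          refine mul_le_mul_of_nonneg_left (add_le_add (add_le_add le_rfl ?_) le_rfl) (by norm_num)
          rw [Finset.mul_sum]
          refine Finset.sum_le_sum fun x _ => (hch x).trans (le_of_eq ?_)
          ring
  -- assemble: `(4 − κ²)|S c̄|² ≤ κ²·(Step C)`, divide by `4 − κ² > 0`
  have h4 : 0 < 4 - κ ^ 2 := by linarith
  have hκ2 : 0 ≤ κ ^ 2 := sq_nonneg κ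
  have hAC := hA.trans (mul_le_mul_of_nonneg_left hC hκ2)
  have hdiv := (le_div_iff₀ h4).mpr ((mul_comm _ _).trans_le hAC)
  refine hdiv.trans (le_of_eq ?_)
  ring

end PolarDatum

/-! ## §4 THE POLAR MASS-FREE END (`δ = 0`) -/

section End

variable {o μ ν β β' : Type*} [Fintype o] [DecidableEq o] [Fintype μ] [Fintype ν] [Fintype β] [DecidableEq β] [Fintype β']
variable {q : μ → ν → ℝ} {W : μ → ν → Matrix o o ℝ} {Q : Matrix (μ × o) (ν × o) ℝ}
variable {src tgt : β → ν} {R : β → Matrix o o ℝ} {src' tgt' : β' → μ} {R' : β' → Matrix o o ℝ}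
variable {Hf : Matrix (ν × o) (ν × o) ℝ} {Hc : Matrix (μ × o) (μ × o) ℝ} {wf wc : ℝ}
variable {σ : β' → ν ≃ ν} {ℓ : ℕ} {xs : β' → ν → ℕ → ν} {γ : β' → ν → ℕ → β} {T : β' → ν → ℕ → Matrix o o ℝ} {m : ℝ}
variable {N : β' → ν → Matrix o o ℝ} {Φ : (ν × o → ℝ) → μ → ℝ} {ϖ ϖ' κ : ℝ}

omit [Fintype μ] in
/-- **`sum_coarseDiff_sq_le_polar` — THE COARSE BOND ENERGY OF THE BLOCK MEAN, POLAR PAIR, NO ADDITIVE TERM** [our proof].  PART 47's letters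
(block weights `q ≥ 0` with `Σ_x q(y,x) = 1`, orthogonal `W, R, R′`, averaging identity `hQ`, fine form bound `hHf`, pairings `σ`, straight chains of
length `ℓ` with q-weighted multiplicity `≤ m`, `w_c·ℓ·m ≤ w_f`, root-frame defects `N` with `|Nw|² ≤ κ²|w|²`), the Poincaré datum `hP` with budgets at
BOTH ends of the coarse bonds (`w_cΣ_{e′}Φ(tgt′e′) ≤ ϖ⟨u,H_fu⟩`, `w_cΣ_{e′}Φ(src′e′) ≤ ϖ′⟨u,H_fu⟩`), the POLAR letter «`Σ_x q(src′e′,x)·N(e′,x)` symmetric»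
and `κ² < 4` ⟹ for all `t, r > 0`:
`w_c·Σ_{e′}|R′_{e′}(Qu)(tgt′e′) − (Qu)(src′e′)|² ≤ (1 + t + (1+t⁻¹)(1+r)ϖκ² + (1+t⁻¹)(1+r⁻¹)·(3κ²∕(4 − κ²))·(1 + ϖ + ϖ′))·⟨u, H_f u⟩`. -/
theorem sum_coarseDiff_sq_le_polar
    (hq : ∀ y x, 0 ≤ q y x) (hq1 : ∀ y, ∑ x, q y x = 1) (hW : ∀ y x, (W y x)ᵀ * W y x = 1) (hR : ∀ e, (R e)ᵀ * R e = 1)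
    (hR' : ∀ e', (R' e')ᵀ * R' e' = 1)
    (hQ : ∀ (u : ν × o → ℝ) (y : μ), (fun a => (Q *ᵥ u) (y, a)) = ∑ x, q y x • (W y x *ᵥ fun b => u (x, b)))
    (hwc : 0 ≤ wc)
    (hHf : ∀ u : ν × o → ℝ, wf * ∑ e, ((R e *ᵥ fun b => u (tgt e, b)) - fun b => u (src e, b)) ⬝ᵥ
        ((R e *ᵥ fun b => u (tgt e, b)) - fun b => u (src e, b)) ≤ u ⬝ᵥ (Hf *ᵥ u))
    (hσq : ∀ e' x, q (tgt' e') (σ e' x) = q (src' e') x)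
    (hx0 : ∀ e' x, xs e' x 0 = x) (hxℓ : ∀ e' x, xs e' x ℓ = σ e' x)
    (hsrc : ∀ e' x i, i < ℓ → src (γ e' x i) = xs e' x i) (htgt : ∀ e' x i, i < ℓ → tgt (γ e' x i) = xs e' x (i + 1))
    (hT0 : ∀ e' x, T e' x 0 = 1) (hT : ∀ e' x i, i < ℓ → T e' x (i + 1) = T e' x i * R (γ e' x i))
    (hmult : ∀ e, ∑ e', ∑ x, ∑ i ∈ range ℓ, (if γ e' x i = e then q (src' e') x else 0) ≤ m)
    (hw : wc * ℓ * m ≤ wf)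
    (hNdef : ∀ e' x, N e' x = 1 - W (src' e') x * T e' x ℓ * (W (tgt' e') (σ e' x))ᵀ * (R' e')ᵀ)
    (hN : ∀ e' x (w : o → ℝ), (N e' x *ᵥ w) ⬝ᵥ (N e' x *ᵥ w) ≤ κ ^ 2 * (w ⬝ᵥ w))
    (hsym : ∀ e', (∑ x, q (src' e') x • N e' x)ᵀ = ∑ x, q (src' e') x • N e' x) (hκ : κ ^ 2 < 4)
    (u : ν × o → ℝ)
    (hP : ∀ y, ∑ x, q y x * (((W y x *ᵥ fun b => u (x, b)) - fun a => (Q *ᵥ u) (y, a)) ⬝ᵥ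
        ((W y x *ᵥ fun b => u (x, b)) - fun a => (Q *ᵥ u) (y, a))) ≤ Φ u y)
    (hΦ : wc * ∑ e', Φ u (tgt' e') ≤ ϖ * (u ⬝ᵥ (Hf *ᵥ u))) (hΦ' : wc * ∑ e', Φ u (src' e') ≤ ϖ' * (u ⬝ᵥ (Hf *ᵥ u)))
    {t r : ℝ} (ht : 0 < t) (hr : 0 < r) :
    wc * ∑ e', ((R' e' *ᵥ fun a => (Q *ᵥ u) (tgt' e', a)) - fun a => (Q *ᵥ u) (src' e', a)) ⬝ᵥ
        ((R' e' *ᵥ fun a => (Q *ᵥ u) (tgt' e', a)) - fun a => (Q *ᵥ u) (src' e', a)) ≤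
      (1 + t + (1 + t⁻¹) * (1 + r) * ϖ * κ ^ 2 + (1 + t⁻¹) * (1 + r⁻¹) * (3 * κ ^ 2 / (4 - κ ^ 2)) * (1 + ϖ + ϖ')) *
        (u ⬝ᵥ (Hf *ᵥ u)) := by
  -- the fine bond energies and the three per-bond sums of the polar mass datum
  set F : β → ℝ := fun e => ((R e *ᵥ fun b => u (tgt e, b)) - fun b => u (src e, b)) ⬝ᵥ
    ((R e *ᵥ fun b => u (tgt e, b)) - fun b => u (src e, b)) with hF
  set P : μ → ℝ := fun y => ∑ x, q y x * (((W y x *ᵥ fun b => u (x, b)) - fun a => (Q *ᵥ u) (y, a)) ⬝ᵥ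
    ((W y x *ᵥ fun b => u (x, b)) - fun a => (Q *ᵥ u) (y, a))) with hPdef
  set C : β' → ℝ := fun e' => ∑ x, q (src' e') x * ∑ i ∈ range ℓ, F (γ e' x i) with hCdef
  have hF0 : ∀ e, 0 ≤ F e := fun e => dotProduct_self_nonneg' _
  have hSF : 0 ≤ ∑ e, F e := Finset.sum_nonneg fun e _ => hF0 e
  have h4 : 0 < 4 - κ ^ 2 := by linarith
  have hcoef : 0 ≤ 3 * κ ^ 2 / (4 - κ ^ 2) := by positivity
  -- the polar mass datum per bond
  have hS : ∀ e', ((∑ x, q (src' e') x • N e' x) *ᵥ (R' e' *ᵥ fun a => (Q *ᵥ u) (tgt' e', a))) ⬝ᵥ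
      ((∑ x, q (src' e') x • N e' x) *ᵥ (R' e' *ᵥ fun a => (Q *ᵥ u) (tgt' e', a))) ≤
        3 * κ ^ 2 / (4 - κ ^ 2) * (P (tgt' e') + ℓ * C e' + P (src' e')) := fun e' =>
    massDatum_polar_le hq hq1 hW hR hR' hσq hx0 hxℓ hsrc htgt hT0 hT hNdef hN hsym hκ u e'
  -- its budget: `w_c·Σ_{e′}(P(tgt′) + ℓ·C + P(src′)) ≤ (ϖ + 1 + ϖ′)·⟨u,H_fu⟩`
  have hPΦ : ∀ y, P y ≤ Φ u y := fun y => hP y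
  have hbud : wc * ∑ e', 3 * κ ^ 2 / (4 - κ ^ 2) * (P (tgt' e') + ℓ * C e' + P (src' e')) ≤
      3 * κ ^ 2 / (4 - κ ^ 2) * (1 + ϖ + ϖ') * (u ⬝ᵥ (Hf *ᵥ u)) := by
    have e1 : wc * ∑ e', 3 * κ ^ 2 / (4 - κ ^ 2) * (P (tgt' e') + ℓ * C e' + P (src' e')) =
        3 * κ ^ 2 / (4 - κ ^ 2) * (wc * ∑ e', P (tgt' e') + wc * (ℓ * ∑ e', C e') + wc * ∑ e', P (src' e')) := by
      rw [← Finset.mul_sum, Finset.sum_add_distrib, Finset.sum_add_distrib, ← Finset.mul_sum]; ring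
    rw [e1]
    have a1 : wc * ∑ e', P (tgt' e') ≤ ϖ * (u ⬝ᵥ (Hf *ᵥ u)) :=
      (mul_le_mul_of_nonneg_left (Finset.sum_le_sum fun e' _ => hPΦ (tgt' e')) hwc).trans hΦ
    have a2 : wc * ∑ e', P (src' e') ≤ ϖ' * (u ⬝ᵥ (Hf *ᵥ u)) :=
      (mul_le_mul_of_nonneg_left (Finset.sum_le_sum fun e' _ => hPΦ (src' e')) hwc).trans hΦ'
    have a3 : wc * (ℓ * ∑ e', C e') ≤ u ⬝ᵥ (Hf *ᵥ u) := by
      have hmu := sum_chain_le_of_multiplicity q src' γ ℓ hmult F hF0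
      calc wc * (ℓ * ∑ e', C e') ≤ wc * (ℓ * (m * ∑ e, F e)) :=
            mul_le_mul_of_nonneg_left (mul_le_mul_of_nonneg_left hmu (Nat.cast_nonneg _)) hwc
        _ = (wc * ℓ * m) * ∑ e, F e := by ring
        _ ≤ wf * ∑ e, F e := mul_le_mul_of_nonneg_right hw hSF
        _ ≤ u ⬝ᵥ (Hf *ᵥ u) := hHf u
    have : wc * ∑ e', P (tgt' e') + wc * (ℓ * ∑ e', C e') + wc * ∑ e', P (src' e') ≤ (1 + ϖ + ϖ') * (u ⬝ᵥ (Hf *ᵥ u)) := by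
      linarith
    calc 3 * κ ^ 2 / (4 - κ ^ 2) * (wc * ∑ e', P (tgt' e') + wc * (ℓ * ∑ e', C e') + wc * ∑ e', P (src' e'))
        ≤ 3 * κ ^ 2 / (4 - κ ^ 2) * ((1 + ϖ + ϖ') * (u ⬝ᵥ (Hf *ᵥ u))) := mul_le_mul_of_nonneg_left this hcoef
      _ = 3 * κ ^ 2 / (4 - κ ^ 2) * (1 + ϖ + ϖ') * (u ⬝ᵥ (Hf *ᵥ u)) := by ring
  have h := sum_coarseDiff_sq_le_massDatum hq (fun y => (hq1 y).le) hW hR hR' hQ hwc hHf hσq hx0 hxℓ hsrc htgt hT0 hT hmult hw hNdef hN u hP hΦ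
    (Ψ := fun e' => 3 * κ ^ 2 / (4 - κ ^ 2) * (P (tgt' e') + ℓ * C e' + P (src' e'))) hS hbud ht hr
  refine h.trans (le_of_eq ?_)
  ring

/-- **`covJensen_polar_massFree` — THE MASS-FREE COVARIANT JENSEN INEQUALITY FOR THE POLAR PAIR** [our proof]: `sum_coarseDiff_sq_le_polar` with a
coarse form `H_c ≤ w_c·Σ_{e′}|R′_{e′}v(tgt′e′) − v(src′e′)|²` ⟹ for all `t, r > 0`:
`⟨Qu, H_cQu⟩ ≤ (1 + t + (1+t⁻¹)(1+r)ϖκ² + (1+t⁻¹)(1+r⁻¹)·(3κ²∕(4 − κ²))·(1 + ϖ + ϖ′))·⟨u, H_f u⟩` — NO additive term. -/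
theorem covJensen_polar_massFree
    (hq : ∀ y x, 0 ≤ q y x) (hq1 : ∀ y, ∑ x, q y x = 1) (hW : ∀ y x, (W y x)ᵀ * W y x = 1) (hR : ∀ e, (R e)ᵀ * R e = 1)
    (hR' : ∀ e', (R' e')ᵀ * R' e' = 1)
    (hQ : ∀ (u : ν × o → ℝ) (y : μ), (fun a => (Q *ᵥ u) (y, a)) = ∑ x, q y x • (W y x *ᵥ fun b => u (x, b)))
    (hwc : 0 ≤ wc)
    (hHc : ∀ v : μ × o → ℝ, v ⬝ᵥ (Hc *ᵥ v) ≤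
      wc * ∑ e', ((R' e' *ᵥ fun a => v (tgt' e', a)) - fun a => v (src' e', a)) ⬝ᵥ
        ((R' e' *ᵥ fun a => v (tgt' e', a)) - fun a => v (src' e', a)))
    (hHf : ∀ u : ν × o → ℝ, wf * ∑ e, ((R e *ᵥ fun b => u (tgt e, b)) - fun b => u (src e, b)) ⬝ᵥ
        ((R e *ᵥ fun b => u (tgt e, b)) - fun b => u (src e, b)) ≤ u ⬝ᵥ (Hf *ᵥ u))
    (hσq : ∀ e' x, q (tgt' e') (σ e' x) = q (src' e') x)
    (hx0 : ∀ e' x, xs e' x 0 = x) (hxℓ : ∀ e' x, xs e' x ℓ = σ e' x)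
    (hsrc : ∀ e' x i, i < ℓ → src (γ e' x i) = xs e' x i) (htgt : ∀ e' x i, i < ℓ → tgt (γ e' x i) = xs e' x (i + 1))
    (hT0 : ∀ e' x, T e' x 0 = 1) (hT : ∀ e' x i, i < ℓ → T e' x (i + 1) = T e' x i * R (γ e' x i))
    (hmult : ∀ e, ∑ e', ∑ x, ∑ i ∈ range ℓ, (if γ e' x i = e then q (src' e') x else 0) ≤ m)
    (hw : wc * ℓ * m ≤ wf)
    (hNdef : ∀ e' x, N e' x = 1 - W (src' e') x * T e' x ℓ * (W (tgt' e') (σ e' x))ᵀ * (R' e')ᵀ)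
    (hN : ∀ e' x (w : o → ℝ), (N e' x *ᵥ w) ⬝ᵥ (N e' x *ᵥ w) ≤ κ ^ 2 * (w ⬝ᵥ w))
    (hsym : ∀ e', (∑ x, q (src' e') x • N e' x)ᵀ = ∑ x, q (src' e') x • N e' x) (hκ : κ ^ 2 < 4)
    (u : ν × o → ℝ)
    (hP : ∀ y, ∑ x, q y x * (((W y x *ᵥ fun b => u (x, b)) - fun a => (Q *ᵥ u) (y, a)) ⬝ᵥ
        ((W y x *ᵥ fun b => u (x, b)) - fun a => (Q *ᵥ u) (y, a))) ≤ Φ u y)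
    (hΦ : wc * ∑ e', Φ u (tgt' e') ≤ ϖ * (u ⬝ᵥ (Hf *ᵥ u))) (hΦ' : wc * ∑ e', Φ u (src' e') ≤ ϖ' * (u ⬝ᵥ (Hf *ᵥ u)))
    {t r : ℝ} (ht : 0 < t) (hr : 0 < r) :
    (Q *ᵥ u) ⬝ᵥ (Hc *ᵥ (Q *ᵥ u)) ≤
      (1 + t + (1 + t⁻¹) * (1 + r) * ϖ * κ ^ 2 + (1 + t⁻¹) * (1 + r⁻¹) * (3 * κ ^ 2 / (4 - κ ^ 2)) * (1 + ϖ + ϖ')) *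
        (u ⬝ᵥ (Hf *ᵥ u)) :=
  (hHc _).trans (sum_coarseDiff_sq_le_polar hq hq1 hW hR hR' hQ hwc hHf hσq hx0 hxℓ hsrc htgt hT0 hT hmult hw hNdef hN hsym hκ u hP hΦ hΦ' ht hr)

/-- **`posSemidef_covJensen_polar_massFree` — (STAB-ε,0) AS THE LOEWNER INEQUALITY PART 20 CONSUMES, WITH `δ = 0`** [our proof]: under the hypotheses
of `covJensen_polar_massFree` for every `u`, with `H_f`, `H_c` symmetric, for all `t, r > 0`:
`((1 + t + (1+t⁻¹)(1+r)ϖκ² + (1+t⁻¹)(1+r⁻¹)(3κ²∕(4 − κ²))(1 + ϖ + ϖ′))•H_f − QᵀH_cQ).PosSemidef` — PART 20's `hstab` with `δ•G` absent. -/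
theorem posSemidef_covJensen_polar_massFree [DecidableEq ν]
    (hq : ∀ y x, 0 ≤ q y x) (hq1 : ∀ y, ∑ x, q y x = 1) (hW : ∀ y x, (W y x)ᵀ * W y x = 1) (hR : ∀ e, (R e)ᵀ * R e = 1)
    (hR' : ∀ e', (R' e')ᵀ * R' e' = 1)
    (hQ : ∀ (u : ν × o → ℝ) (y : μ), (fun a => (Q *ᵥ u) (y, a)) = ∑ x, q y x • (W y x *ᵥ fun b => u (x, b)))
    (hwc : 0 ≤ wc) (hHfs : Hfᵀ = Hf) (hHcs : Hcᵀ = Hc)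
    (hHc : ∀ v : μ × o → ℝ, v ⬝ᵥ (Hc *ᵥ v) ≤
      wc * ∑ e', ((R' e' *ᵥ fun a => v (tgt' e', a)) - fun a => v (src' e', a)) ⬝ᵥ
        ((R' e' *ᵥ fun a => v (tgt' e', a)) - fun a => v (src' e', a)))
    (hHf : ∀ u : ν × o → ℝ, wf * ∑ e, ((R e *ᵥ fun b => u (tgt e, b)) - fun b => u (src e, b)) ⬝ᵥ
        ((R e *ᵥ fun b => u (tgt e, b)) - fun b => u (src e, b)) ≤ u ⬝ᵥ (Hf *ᵥ u))
    (hσq : ∀ e' x, q (tgt' e') (σ e' x) = q (src' e') x)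
    (hx0 : ∀ e' x, xs e' x 0 = x) (hxℓ : ∀ e' x, xs e' x ℓ = σ e' x)
    (hsrc : ∀ e' x i, i < ℓ → src (γ e' x i) = xs e' x i) (htgt : ∀ e' x i, i < ℓ → tgt (γ e' x i) = xs e' x (i + 1))
    (hT0 : ∀ e' x, T e' x 0 = 1) (hT : ∀ e' x i, i < ℓ → T e' x (i + 1) = T e' x i * R (γ e' x i))
    (hmult : ∀ e, ∑ e', ∑ x, ∑ i ∈ range ℓ, (if γ e' x i = e then q (src' e') x else 0) ≤ m)
    (hw : wc * ℓ * m ≤ wf)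
    (hNdef : ∀ e' x, N e' x = 1 - W (src' e') x * T e' x ℓ * (W (tgt' e') (σ e' x))ᵀ * (R' e')ᵀ)
    (hN : ∀ e' x (w : o → ℝ), (N e' x *ᵥ w) ⬝ᵥ (N e' x *ᵥ w) ≤ κ ^ 2 * (w ⬝ᵥ w))
    (hsym : ∀ e', (∑ x, q (src' e') x • N e' x)ᵀ = ∑ x, q (src' e') x • N e' x) (hκ : κ ^ 2 < 4)
    (hP : ∀ (u : ν × o → ℝ) y, ∑ x, q y x * (((W y x *ᵥ fun b => u (x, b)) - fun a => (Q *ᵥ u) (y, a)) ⬝ᵥ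
        ((W y x *ᵥ fun b => u (x, b)) - fun a => (Q *ᵥ u) (y, a))) ≤ Φ u y)
    (hΦ : ∀ u : ν × o → ℝ, wc * ∑ e', Φ u (tgt' e') ≤ ϖ * (u ⬝ᵥ (Hf *ᵥ u)))
    (hΦ' : ∀ u : ν × o → ℝ, wc * ∑ e', Φ u (src' e') ≤ ϖ' * (u ⬝ᵥ (Hf *ᵥ u)))
    {t r : ℝ} (ht : 0 < t) (hr : 0 < r) :
    ((1 + t + (1 + t⁻¹) * (1 + r) * ϖ * κ ^ 2 + (1 + t⁻¹) * (1 + r⁻¹) * (3 * κ ^ 2 / (4 - κ ^ 2)) * (1 + ϖ + ϖ')) • Hf -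
      Qᵀ * Hc * Q).PosSemidef := by
  refine PosSemidef.of_dotProduct_mulVec_nonneg ?_ fun u => ?_
  · rw [Matrix.IsHermitian, Matrix.conjTranspose_eq_transpose_of_trivial, transpose_sub, transpose_smul, hHfs, transpose_mul,
      transpose_mul, transpose_transpose, hHcs, Matrix.mul_assoc]
  · simp only [star_trivial, sub_mulVec, dotProduct_sub, smul_mulVec, dotProduct_smul, smul_eq_mul, sub_nonneg]
    have e1 : u ⬝ᵥ ((Qᵀ * Hc * Q) *ᵥ u) = (Q *ᵥ u) ⬝ᵥ (Hc *ᵥ (Q *ᵥ u)) := by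
      rw [mulVec_dotProduct_eq, mulVec_mulVec, mulVec_mulVec, Matrix.mul_assoc]
    rw [e1]
    exact covJensen_polar_massFree hq hq1 hW hR hR' hQ hwc hHc hHf hσq hx0 hxℓ hsrc htgt hT0 hT hmult hw hNdef hN hsym hκ u (hP u) (hΦ u)
      (hΦ' u) ht hr

end End

end Summit.QuantumFields.BalabanUV.Beta.GAN24.DerivativeRateTransferJensenMassFreeEnd

end
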